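import Literature.AnabelianGeometry.EtaleTheta.Discharge.Sec3Cor38iWeakOfRatSupport
import Literature.AnabelianGeometry.EtaleTheta.Discharge.Sec3Cor38iiWeak
import Literature.AnabelianGeometry.EtaleTheta.Discharge.Sec3Remark363OfRlfWeak
import HarnessLib

/-!
# [EtTh] Corollary 3.8 (ii) AS TYPED over the WEAK canonical monoid vocabulary from print-level clauses only:
# the criterion C38-L05 consumed from RATIONAL SUPPORT and Rmk. 3.6.3 from `(hP34Λ, hFinv)`, also at the
# constructed `Ÿ` / `Z_∞`-type data `ofRlfZWeak` / `ofRlfQWeak`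

S. Mochizuki, *The étale theta function and its Frobenioid-theoretic manifestations*, Publ. RIMS **45** (2009),
Cor. 3.8 (ii), statement PDF p. 80, proof p. 81 l. 5–8 and l. 33 – p. 82 l. 5 [cite: MochizukiEtTh2009, Cor 3.8 p.81];
Def. 3.6 (i)/(ii) pp. 76–77, Remark 3.3.1 p. 73, Prop. 3.4 (ii) p. 74, Remark 3.6.3 p. 79; S. Mochizuki, *The geometry
of Frobenioids I* (2008), Cor. 4.11 (ii) p. 91, Def. 2.4 (i) pp. 47–48 [cite: MochizukiFrdI2008, Cor. 4.11 (ii) p.91].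

abc-iut cell, layer L2 consumer knit written by the L1 seat abc-iut-L1-t12 (gen 6), cone node `EtTh:Cor3.8(ii)`
(kernel id `N_EtTh_Cor3_8_ii`); PROOF-ONLY sequel (0 definitions) of this seat's `Discharge/Sec3Cor38iiWeak.lean`
(p441772: the (ii) node closer at the WEAK vocabulary with the criteria / Rmk. 3.6.3 as binders or from abc-iut-w4-d084's
`…_of_coordWeak` + abc-iut-w5-d135's `remark363_of_isSharp`; [FrdI] Cor. 4.11 (ii) DISCHARGED there through this
seat's weak L1 chain p440209) — the (ii)-sibling of abc-iut-w6-d039's `Sec3Cor38iWeakOfRatSupport.lean` (p439836),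
with the SAME input lists plus Rmk. 3.6.3's `hFinv` / `hF₀inv` (as in abc-iut-w6-d040's strong
`cor38_ii_canonical_of_ratSupport_of_hFinv` / `cor38_ii_ofRlfZ_of_ratSupport`):

* §1 `Cor38Hyp.cor38_ii_weak_of_ratSupport` (weak monoid vocabulary, ANY category vocabularies): inputs `hF_i`
  ([FrdI] Thm. 5.2 (ii)) and, per side, `hP34Λ_i` (Prop. 3.4 (ii) at monoid type `Λ`), `hNZ_i` (Def. 3.6 (ii)(b)),
  `hZQ_i` (Rmk. 3.3.1), `hsat_i` (Def. 3.6 (i)/(ii): rational support), `hFinv_i` (Def. 3.6 (ii)(b)/(iii): `F^Λ`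
  stable under inverse) — C38-L05 := abc-iut-L6-t12's `bsFldPreStepLimitCriterion_of_ratSupport_weak` (W7), Rmk. 3.6.3
  := `remark363_of_isSharp`;
* §2 `Cor38Hyp.cor38_ii_weak_of_ratSupport_of_structural` (canonical category vocabulary): `hBinj_i`, `hFSM_i`
  (⟹ `hF_i`, abc-iut-L2-t3's `isFrobenioid_of_structural`), `hP_i : T_i.Prop34Cnst cnst_i` (⟹ `hP34Λ_i`), `hNZ_i`,
  `hZQ_i`, `hsat_i`, `hFinv_i` — every input a named print-level clause;
* §3 at the weak CONSTRUCTED data of monoid type `ℤ` / `ℚ` (`RealifiedDivisorMonoids.ofRlfZWeak` / `ofRlfQWeak`, the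
  `Ÿ` / `Z_∞`-type data of F-L2d2-1): `Cor38Hyp.cor38_ii_ofRlfZWeak_of_ratSupport` / `…_ofRlfQWeak_of_ratSupport`
  (any category vocabularies; inputs `hF_i`, `dm_i.Prop34`, `hF₀inv_i`, `hcyc_i`, `hZQ_i`, `hsat_i` — `B₀`/`Φ₀`-level
  statements only; Rmk. 3.6.3 by abc-iut-L6-t12's W4 `remark363_ofRlfZWeak` / `…QWeak`), `…_of_prop34Const`
  (`hcyc_i` ⟸ `dm_i.Prop34Const`), and `…_of_structural` (canonical category vocabulary: `hB₀inj_i`, `hFSM_i`).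

Nothing of abc-iut-L6-t12 / w6-d039 / w6-d040 / w4-d084 / w5-d135 / L2-d2 / L2-t3 is re-derived; no statement of print
is strengthened: `hsat`, `hcyc`, `hNZ`, `hZQ`, `hF₀inv` are print's standing situation for the geometric data and NOT
derivable from the typed interfaces (kernel certificates `ToyHNZ` p427694, `Sec3Cor38CriterionToy` p425444,
`Sec3Cor38iStatementToy` p432851; GAP G-w5d135-1 for `hF₀inv`).  HONEST FRAMING: refereed pre-IUT material ([EtTh] §3
over [FrdI] §§2–5); nothing here bears on [IUTchIII] Cor. 3.12; no side taken; typed ≠ proved — here proved modulo the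
named binders.
-/

noncomputable section

namespace Literature.AnabelianGeometry.EtaleTheta

open CategoryTheory Opposite Function Literature.AlgebraicGeometry.Frobenioids

universe u₀ v₀ u v w u₁ v₁

namespace Cor38Hyp

/-! ## §1 Weak monoid vocabulary, any category vocabularies -/

section Weak

variable {D₀ : Type u₀} [Category.{v₀} D₀] {D₀' : Type u₀} [Category.{v₀} D₀']
  {D : Type u} [Category.{v} D] {D' : Type u} [Category.{v} D']
  {VD : FrdICatStub.{u, v, w} D} {VD' : FrdICatStub.{u, v, w} D'}

/-- **[EtTh] Cor. 3.8 (ii) AS TYPED over the WEAK canonical monoid vocabulary, ANY category vocabularies, the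
criterion C38-L05 consumed from rational support and Rmk. 3.6.3 from `(hP34Λ, hFinv)`** (vocabulary parameter := [FrdI]
Def. 4.5 (iv) read on `(E, Φ)`, as in `cor38_ii_of_criterion_tree`): inputs `hF_i` ([FrdI] Thm. 5.2 (ii)) and, per side,
`hP34Λ_i`, `hNZ_i`, `hZQ_i`, `hsat_i`, `hFinv_i`; C38-L05 := abc-iut-L6-t12's `bsFldPreStepLimitCriterion_of_ratSupport_weak`,
Rmk. 3.6.3 := abc-iut-w5-d135's `remark363_of_isSharp` (sharp: weakly perf-factorial ⟹ divisorial), the rest :=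
`cor38_ii_weak_of_criteria` (C38-L01, [FrdI] Thm. 3.4 (ii), Cor. 4.11 (ii) tree theorems at the weak vocabulary).
[cite: MochizukiEtTh2009, Cor 3.8 p.81] -/
theorem cor38_ii_weak_of_ratSupport
    {T : RealifiedDivisorMonoids (D₀ := D₀) treeMonoidVocabWeak.{w}}
    {T' : RealifiedDivisorMonoids (D₀ := D₀') treeMonoidVocabWeak.{w}}
    {C₁ : TemperedFrobenioid T D VD} {C₂ : TemperedFrobenioid T' D' VD'} (h : Cor38Hyp C₁ C₂)
    (hF₁ : PreFrobenioid.IsFrobenioid C₁.toElem) (hF₂ : PreFrobenioid.IsFrobenioid C₂.toElem)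
    (hP34Λ₁ : ∀ (Y : D₀ᵒᵖ) (b : T.BΛ.obj Y) (r : T.ΦR.obj Y),
      T.divΛ Y b = Algebra.GrothendieckGroup.of r → b ∈ T.FΛ Y)
    (hNZ₁ : ∀ A : Dᵒᵖ, ∃ u : (T.BΛ.obj (C₁.baseOp A) : Type w) × Algebra.GrothendieckGroup (C₁.Φ.carrier A),
      u ∈ C₁.cnstFn A ∧ ∃ Z : C₁.Φ.carrier A, Z ≠ 1 ∧ u.2 = Algebra.GrothendieckGroup.of Z)
    (hZQ₁ : ∀ (W : D) (𝔭 : Primes (T.Φ₀.obj (C₁.baseOp (op W)))),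
      IsZMonoprime ↥𝔭.submonoid ∨ IsQMonoprime ↥𝔭.submonoid)
    (hsat₁ : ∀ (W : D), ∀ x ∈ C₁.Φ.carrier (op W), ∃ (N : ℕ+) (d : T.Φ₀.obj (C₁.baseOp (op W))),
      x ^ (N : ℕ) = T.toR (C₁.baseOp (op W)) d)
    (hFinv₁ : ∀ (Y : D₀ᵒᵖ) (b : T.BΛ.obj Y), b ∈ T.FΛ Y → ∃ b' ∈ T.FΛ Y, b' * b = 1)
    (hP34Λ₂ : ∀ (Y : D₀'ᵒᵖ) (b : T'.BΛ.obj Y) (r : T'.ΦR.obj Y),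
      T'.divΛ Y b = Algebra.GrothendieckGroup.of r → b ∈ T'.FΛ Y)
    (hNZ₂ : ∀ A : D'ᵒᵖ, ∃ u : (T'.BΛ.obj (C₂.baseOp A) : Type w) × Algebra.GrothendieckGroup (C₂.Φ.carrier A),
      u ∈ C₂.cnstFn A ∧ ∃ Z : C₂.Φ.carrier A, Z ≠ 1 ∧ u.2 = Algebra.GrothendieckGroup.of Z)
    (hZQ₂ : ∀ (W : D') (𝔭 : Primes (T'.Φ₀.obj (C₂.baseOp (op W)))),
      IsZMonoprime ↥𝔭.submonoid ∨ IsQMonoprime ↥𝔭.submonoid)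
    (hsat₂ : ∀ (W : D'), ∀ x ∈ C₂.Φ.carrier (op W), ∃ (N : ℕ+) (d : T'.Φ₀.obj (C₂.baseOp (op W))),
      x ^ (N : ℕ) = T'.toR (C₂.baseOp (op W)) d)
    (hFinv₂ : ∀ (Y : D₀'ᵒᵖ) (b : T'.BΛ.obj Y), b ∈ T'.FΛ Y → ∃ b' ∈ T'.FΛ Y, b' * b = 1) :
    Literature.AnabelianGeometry.EtaleTheta.Cor38_ii
      (fun E _ Φ => ∀ (A : E) (α : Aut (Over.forget A)),
        (∀ (B : Over A) (x : Φ.obj (op B.left)),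
          Literature.AlgebraicGeometry.Frobenioids.pull Φ (α.hom.app B) x = x) → α = 1) h :=
  h.cor38_ii_weak_of_criteria hF₁ hF₂
    (C₁.bsFldPreStepLimitCriterion_of_ratSupport_weak hF₁ hP34Λ₁ hNZ₁ hZQ₁ hsat₁)
    (C₂.bsFldPreStepLimitCriterion_of_ratSupport_weak hF₂ hP34Λ₂ hNZ₂ hZQ₂ hsat₂)
    (C₁.remark363_of_isSharp (fun A => (C₁.objectwise_isDivisorial_weak A).isSharp) hP34Λ₁ hFinv₁)
    (C₂.remark363_of_isSharp (fun A => (C₂.objectwise_isDivisorial_weak A).isSharp) hP34Λ₂ hFinv₂)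

end Weak

/-! ## §2 Weak monoid vocabulary at the canonical category vocabulary `treeCatVocab` -/

section WeakCanonical

variable {D₀ : Type u₀} [Category.{v₀} D₀] {D₀' : Type u₀} [Category.{v₀} D₀']
  {D : Type u} [Category.{v} D] {D' : Type u} [Category.{v} D']
  {IsRational IsStrictlyRational : (Dᵒᵖ ⥤ CommMonCat.{w}) → Prop}
  {IsRational' IsStrictlyRational' : (D'ᵒᵖ ⥤ CommMonCat.{w}) → Prop}

/-- **[EtTh] Cor. 3.8 (ii) AS TYPED over the WEAK monoid vocabulary at the canonical category vocabulary from NAMED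
PRINT-LEVEL CLAUSES ONLY** — per side: `hBinj_i`, `hFSM_i` (⟹ `hF_i`, abc-iut-L2-t3's `isFrobenioid_of_structural`),
`hP_i : T_i.Prop34Cnst cnst_i` (⟹ `hP34Λ_i`), `hNZ_i`, `hZQ_i`, `hsat_i`, `hFinv_i` (the weak-vocabulary twin of
abc-iut-w6-d040's `cor38_ii_canonical_of_structural` with `hFinv` kept, as in its `…_of_hFinv` form).
[cite: MochizukiEtTh2009, Cor 3.8 p.81] -/
theorem cor38_ii_weak_of_ratSupport_of_structural
    {T : RealifiedDivisorMonoids (D₀ := D₀) treeMonoidVocabWeak.{w}}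
    {T' : RealifiedDivisorMonoids (D₀ := D₀') treeMonoidVocabWeak.{w}}
    {C₁ : TemperedFrobenioid T D (treeCatVocab D IsRational IsStrictlyRational)}
    {C₂ : TemperedFrobenioid T' D' (treeCatVocab D' IsRational' IsStrictlyRational')} (h : Cor38Hyp C₁ C₂)
    {Dcnst : Type u₁} [Category.{v₁} Dcnst] {cnst : D₀ ⥤ Dcnst}
    {Dcnst' : Type u₁} [Category.{v₁} Dcnst'] {cnst' : D₀' ⥤ Dcnst'}
    (hBinj₁ : ∀ {Y Y' : D₀ᵒᵖ} (g : Y ⟶ Y'), Injective (T.BΛ.map g).hom)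
    (hFSM₁ : ∀ {A B : D} (α : B ⟶ A), IsFSM α → IsIso α)
    (hP₁ : T.Prop34Cnst cnst)
    (hNZ₁ : ∀ A : Dᵒᵖ, ∃ u : (T.BΛ.obj (C₁.baseOp A) : Type w) × Algebra.GrothendieckGroup (C₁.Φ.carrier A),
      u ∈ C₁.cnstFn A ∧ ∃ Z : C₁.Φ.carrier A, Z ≠ 1 ∧ u.2 = Algebra.GrothendieckGroup.of Z)
    (hZQ₁ : ∀ (W : D) (𝔭 : Primes (T.Φ₀.obj (C₁.baseOp (op W)))),
      IsZMonoprime ↥𝔭.submonoid ∨ IsQMonoprime ↥𝔭.submonoid)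
    (hsat₁ : ∀ (W : D), ∀ x ∈ C₁.Φ.carrier (op W), ∃ (N : ℕ+) (d : T.Φ₀.obj (C₁.baseOp (op W))),
      x ^ (N : ℕ) = T.toR (C₁.baseOp (op W)) d)
    (hFinv₁ : ∀ (Y : D₀ᵒᵖ) (b : T.BΛ.obj Y), b ∈ T.FΛ Y → ∃ b' ∈ T.FΛ Y, b' * b = 1)
    (hBinj₂ : ∀ {Y Y' : D₀'ᵒᵖ} (g : Y ⟶ Y'), Injective (T'.BΛ.map g).hom)
    (hFSM₂ : ∀ {A B : D'} (α : B ⟶ A), IsFSM α → IsIso α)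
    (hP₂ : T'.Prop34Cnst cnst')
    (hNZ₂ : ∀ A : D'ᵒᵖ, ∃ u : (T'.BΛ.obj (C₂.baseOp A) : Type w) × Algebra.GrothendieckGroup (C₂.Φ.carrier A),
      u ∈ C₂.cnstFn A ∧ ∃ Z : C₂.Φ.carrier A, Z ≠ 1 ∧ u.2 = Algebra.GrothendieckGroup.of Z)
    (hZQ₂ : ∀ (W : D') (𝔭 : Primes (T'.Φ₀.obj (C₂.baseOp (op W)))),
      IsZMonoprime ↥𝔭.submonoid ∨ IsQMonoprime ↥𝔭.submonoid)
    (hsat₂ : ∀ (W : D'), ∀ x ∈ C₂.Φ.carrier (op W), ∃ (N : ℕ+) (d : T'.Φ₀.obj (C₂.baseOp (op W))),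
      x ^ (N : ℕ) = T'.toR (C₂.baseOp (op W)) d)
    (hFinv₂ : ∀ (Y : D₀'ᵒᵖ) (b : T'.BΛ.obj Y), b ∈ T'.FΛ Y → ∃ b' ∈ T'.FΛ Y, b' * b = 1) :
    Literature.AnabelianGeometry.EtaleTheta.Cor38_ii
      (fun E _ Φ => ∀ (A : E) (α : Aut (Over.forget A)),
        (∀ (B : Over A) (x : Φ.obj (op B.left)),
          Literature.AlgebraicGeometry.Frobenioids.pull Φ (α.hom.app B) x = x) → α = 1) h :=
  h.cor38_ii_weak_of_ratSupport (C₁.isFrobenioid_of_structural hBinj₁ hFSM₁)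
    (C₂.isFrobenioid_of_structural hBinj₂ hFSM₂) hP₁.mem_FΛ_of_divΛ_eq_of hNZ₁ hZQ₁ hsat₁ hFinv₁
    hP₂.mem_FΛ_of_divΛ_eq_of hNZ₂ hZQ₂ hsat₂ hFinv₂

end WeakCanonical

/-! ## §3 Both tempered Frobenioids over the weak CONSTRUCTED Def. 3.6 (i) data `ofRlfZWeak` / `ofRlfQWeak` -/

section OfRlfWeak

variable {D₀ : Type u₀} [Category.{v₀} D₀] {dm₁ : DivisorMonoids.{u₀, v₀, w} D₀}
  {hpf₁ : ∀ Y : D₀ᵒᵖ, IsPerfFactorialCof (dm₁.Φ₀.obj Y)}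
  {V₁ : FrdIMonoidStub.{w}} {V₀₁ : FrdICatStub.{u₀, v₀, w} D₀}
  {D₀' : Type u₀} [Category.{v₀} D₀'] {dm₂ : DivisorMonoids.{u₀, v₀, w} D₀'}
  {hpf₂ : ∀ Y : D₀'ᵒᵖ, IsPerfFactorialCof (dm₂.Φ₀.obj Y)}
  {V₂ : FrdIMonoidStub.{w}} {V₀₂ : FrdICatStub.{u₀, v₀, w} D₀'}
  {D : Type u} [Category.{v} D] {D' : Type u} [Category.{v} D']
  {VD : FrdICatStub.{u, v, w} D} {VD' : FrdICatStub.{u, v, w} D'}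
  {IsRational IsStrictlyRational : (Dᵒᵖ ⥤ CommMonCat.{w}) → Prop}
  {IsRational' IsStrictlyRational' : (D'ᵒᵖ ⥤ CommMonCat.{w}) → Prop}

/-- **[EtTh] Cor. 3.8 (ii) AS TYPED for two tempered Frobenioids over the WEAK constructed Def. 3.6 (i) data of
monoid type `ℤ`** (`RealifiedDivisorMonoids.ofRlfZWeak dm hpf`: the `Ÿ` / `Z_∞`-type data of F-L2d2-1), ANY category
vocabularies, modulo `hF_i` ([FrdI] Thm. 5.2 (ii)) and `B₀`/`Φ₀`-LEVEL PRINT STATEMENTS ONLY: `dm_i.Prop34` (the typed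
Prop. 3.4 structure), `hF₀inv_i` ("`F₀(Y) ≅ L^×` is a group", Prop. 3.4 (ii); GAP G-w5d135-1), `hcyc_i` (Def. 3.6
(ii)(b)), `hZQ_i` (Rmk. 3.3.1), `hsat_i` (rational support) — C38-L05 by abc-iut-L6-t12's
`bsFldPreStepLimitCriterion_ofRlfZWeak_of_ratSupport` (W7), Rmk. 3.6.3 by its `remark363_ofRlfZWeak` (W4); the (ii)-twin of
abc-iut-w6-d039's `cor38_i_ofRlfZWeak_of_ratSupport` and weak twin of abc-iut-w6-d040's `cor38_ii_ofRlfZ_of_ratSupport`.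
[cite: MochizukiEtTh2009, Cor 3.8 p.81] -/
theorem cor38_ii_ofRlfZWeak_of_ratSupport
    {C₁ : TemperedFrobenioid (RealifiedDivisorMonoids.ofRlfZWeak dm₁ hpf₁) D VD}
    {C₂ : TemperedFrobenioid (RealifiedDivisorMonoids.ofRlfZWeak dm₂ hpf₂) D' VD'}
    (h : Cor38Hyp C₁ C₂)
    (hF₁ : PreFrobenioid.IsFrobenioid C₁.toElem) (hF₂ : PreFrobenioid.IsFrobenioid C₂.toElem)
    (h34₁ : dm₁.Prop34 V₁ V₀₁)
    (hF₀inv₁ : ∀ (Y : D₀ᵒᵖ) (b : dm₁.B₀.obj Y), b ∈ dm₁.F₀ Y → ∃ b' ∈ dm₁.F₀ Y, b' * b = 1)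
    (hcyc₁ : ∀ Y : D₀ᵒᵖ, ∃ d : dm₁.Φ₀.obj Y, ∀ b ∈ dm₁.F₀ Y, ∃ n : ℤ,
      dm₁.div₀ Y b = Algebra.GrothendieckGroup.of d ^ n)
    (hZQ₁ : ∀ (W : D) (𝔭 : Primes (dm₁.Φ₀.obj (C₁.baseOp (op W)))),
      IsZMonoprime ↥𝔭.submonoid ∨ IsQMonoprime ↥𝔭.submonoid)
    (hsat₁ : ∀ (W : D), ∀ x ∈ C₁.Φ.carrier (op W), ∃ (N : ℕ+) (d : dm₁.Φ₀.obj (C₁.baseOp (op W))),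
      x ^ (N : ℕ) = (hpf₁ (C₁.baseOp (op W))).weak.toRealification (Perfection.of _ d))
    (h34₂ : dm₂.Prop34 V₂ V₀₂)
    (hF₀inv₂ : ∀ (Y : D₀'ᵒᵖ) (b : dm₂.B₀.obj Y), b ∈ dm₂.F₀ Y → ∃ b' ∈ dm₂.F₀ Y, b' * b = 1)
    (hcyc₂ : ∀ Y : D₀'ᵒᵖ, ∃ d : dm₂.Φ₀.obj Y, ∀ b ∈ dm₂.F₀ Y, ∃ n : ℤ,
      dm₂.div₀ Y b = Algebra.GrothendieckGroup.of d ^ n)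
    (hZQ₂ : ∀ (W : D') (𝔭 : Primes (dm₂.Φ₀.obj (C₂.baseOp (op W)))),
      IsZMonoprime ↥𝔭.submonoid ∨ IsQMonoprime ↥𝔭.submonoid)
    (hsat₂ : ∀ (W : D'), ∀ x ∈ C₂.Φ.carrier (op W), ∃ (N : ℕ+) (d : dm₂.Φ₀.obj (C₂.baseOp (op W))),
      x ^ (N : ℕ) = (hpf₂ (C₂.baseOp (op W))).weak.toRealification (Perfection.of _ d)) :
    Literature.AnabelianGeometry.EtaleTheta.Cor38_ii
      (fun E _ Φ => ∀ (A : E) (α : Aut (Over.forget A)),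
        (∀ (B : Over A) (x : Φ.obj (op B.left)),
          Literature.AlgebraicGeometry.Frobenioids.pull Φ (α.hom.app B) x = x) → α = 1) h :=
  h.cor38_ii_weak_of_criteria hF₁ hF₂
    (C₁.bsFldPreStepLimitCriterion_ofRlfZWeak_of_ratSupport hF₁ h34₁ hcyc₁ hZQ₁ hsat₁)
    (C₂.bsFldPreStepLimitCriterion_ofRlfZWeak_of_ratSupport hF₂ h34₂ hcyc₂ hZQ₂ hsat₂)
    (C₁.remark363_ofRlfZWeak h34₁ hF₀inv₁) (C₂.remark363_ofRlfZWeak h34₂ hF₀inv₂)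

/-- The same with `hcyc_i` read from abc-iut-L2-t3's binder of record `dm_i.Prop34Const` ([EtTh] Prop. 3.4 (ii),
third isomorphism `F₀(Y) ≅ L^×` with `div(ϖ_L)`). [cite: MochizukiEtTh2009, Cor 3.8 p.81] -/
theorem cor38_ii_ofRlfZWeak_of_ratSupport_of_prop34Const
    {C₁ : TemperedFrobenioid (RealifiedDivisorMonoids.ofRlfZWeak dm₁ hpf₁) D VD}
    {C₂ : TemperedFrobenioid (RealifiedDivisorMonoids.ofRlfZWeak dm₂ hpf₂) D' VD'}
    (h : Cor38Hyp C₁ C₂)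
    (hF₁ : PreFrobenioid.IsFrobenioid C₁.toElem) (hF₂ : PreFrobenioid.IsFrobenioid C₂.toElem)
    (h34₁ : dm₁.Prop34 V₁ V₀₁) (hC₁ : dm₁.Prop34Const)
    (hF₀inv₁ : ∀ (Y : D₀ᵒᵖ) (b : dm₁.B₀.obj Y), b ∈ dm₁.F₀ Y → ∃ b' ∈ dm₁.F₀ Y, b' * b = 1)
    (hZQ₁ : ∀ (W : D) (𝔭 : Primes (dm₁.Φ₀.obj (C₁.baseOp (op W)))),
      IsZMonoprime ↥𝔭.submonoid ∨ IsQMonoprime ↥𝔭.submonoid)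
    (hsat₁ : ∀ (W : D), ∀ x ∈ C₁.Φ.carrier (op W), ∃ (N : ℕ+) (d : dm₁.Φ₀.obj (C₁.baseOp (op W))),
      x ^ (N : ℕ) = (hpf₁ (C₁.baseOp (op W))).weak.toRealification (Perfection.of _ d))
    (h34₂ : dm₂.Prop34 V₂ V₀₂) (hC₂ : dm₂.Prop34Const)
    (hF₀inv₂ : ∀ (Y : D₀'ᵒᵖ) (b : dm₂.B₀.obj Y), b ∈ dm₂.F₀ Y → ∃ b' ∈ dm₂.F₀ Y, b' * b = 1)
    (hZQ₂ : ∀ (W : D') (𝔭 : Primes (dm₂.Φ₀.obj (C₂.baseOp (op W)))),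
      IsZMonoprime ↥𝔭.submonoid ∨ IsQMonoprime ↥𝔭.submonoid)
    (hsat₂ : ∀ (W : D'), ∀ x ∈ C₂.Φ.carrier (op W), ∃ (N : ℕ+) (d : dm₂.Φ₀.obj (C₂.baseOp (op W))),
      x ^ (N : ℕ) = (hpf₂ (C₂.baseOp (op W))).weak.toRealification (Perfection.of _ d)) :
    Literature.AnabelianGeometry.EtaleTheta.Cor38_ii
      (fun E _ Φ => ∀ (A : E) (α : Aut (Over.forget A)),
        (∀ (B : Over A) (x : Φ.obj (op B.left)),
          Literature.AlgebraicGeometry.Frobenioids.pull Φ (α.hom.app B) x = x) → α = 1) h :=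
  h.cor38_ii_ofRlfZWeak_of_ratSupport hF₁ hF₂ h34₁ hF₀inv₁ hC₁.hcyc hZQ₁ hsat₁ h34₂ hF₀inv₂ hC₂.hcyc hZQ₂ hsat₂

/-- **[EtTh] Cor. 3.8 (ii) AS TYPED over the weak constructed `Λ = ℤ` data from NAMED `B₀`/`Φ₀`/`D`-LEVEL CLAUSES
ONLY** (canonical category vocabulary): `hF_i` ⟸ (`hB₀inj_i`, `hFSM_i`) through abc-iut-L2-t3's
`isFrobenioid_of_structural` ∘ `RealifiedDivisorMonoids.ofRlfZWeak_hBinj`.  Inputs per side: `hB₀inj_i`, `hFSM_i`,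
`dm_i.Prop34`, `hF₀inv_i`, `hcyc_i`, `hZQ_i`, `hsat_i`. [cite: MochizukiEtTh2009, Cor 3.8 p.81] -/
theorem cor38_ii_ofRlfZWeak_of_structural
    {C₁ : TemperedFrobenioid (RealifiedDivisorMonoids.ofRlfZWeak dm₁ hpf₁) D
      (treeCatVocab D IsRational IsStrictlyRational)}
    {C₂ : TemperedFrobenioid (RealifiedDivisorMonoids.ofRlfZWeak dm₂ hpf₂) D'
      (treeCatVocab D' IsRational' IsStrictlyRational')}
    (h : Cor38Hyp C₁ C₂)
    (hB₀inj₁ : ∀ {Y Y' : D₀ᵒᵖ} (g : Y ⟶ Y'), Injective (dm₁.B₀.map g).hom)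
    (hFSM₁ : ∀ {A B : D} (α : B ⟶ A), IsFSM α → IsIso α)
    (h34₁ : dm₁.Prop34 V₁ V₀₁)
    (hF₀inv₁ : ∀ (Y : D₀ᵒᵖ) (b : dm₁.B₀.obj Y), b ∈ dm₁.F₀ Y → ∃ b' ∈ dm₁.F₀ Y, b' * b = 1)
    (hcyc₁ : ∀ Y : D₀ᵒᵖ, ∃ d : dm₁.Φ₀.obj Y, ∀ b ∈ dm₁.F₀ Y, ∃ n : ℤ,
      dm₁.div₀ Y b = Algebra.GrothendieckGroup.of d ^ n)
    (hZQ₁ : ∀ (W : D) (𝔭 : Primes (dm₁.Φ₀.obj (C₁.baseOp (op W)))),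
      IsZMonoprime ↥𝔭.submonoid ∨ IsQMonoprime ↥𝔭.submonoid)
    (hsat₁ : ∀ (W : D), ∀ x ∈ C₁.Φ.carrier (op W), ∃ (N : ℕ+) (d : dm₁.Φ₀.obj (C₁.baseOp (op W))),
      x ^ (N : ℕ) = (hpf₁ (C₁.baseOp (op W))).weak.toRealification (Perfection.of _ d))
    (hB₀inj₂ : ∀ {Y Y' : D₀'ᵒᵖ} (g : Y ⟶ Y'), Injective (dm₂.B₀.map g).hom)
    (hFSM₂ : ∀ {A B : D'} (α : B ⟶ A), IsFSM α → IsIso α)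
    (h34₂ : dm₂.Prop34 V₂ V₀₂)
    (hF₀inv₂ : ∀ (Y : D₀'ᵒᵖ) (b : dm₂.B₀.obj Y), b ∈ dm₂.F₀ Y → ∃ b' ∈ dm₂.F₀ Y, b' * b = 1)
    (hcyc₂ : ∀ Y : D₀'ᵒᵖ, ∃ d : dm₂.Φ₀.obj Y, ∀ b ∈ dm₂.F₀ Y, ∃ n : ℤ,
      dm₂.div₀ Y b = Algebra.GrothendieckGroup.of d ^ n)
    (hZQ₂ : ∀ (W : D') (𝔭 : Primes (dm₂.Φ₀.obj (C₂.baseOp (op W)))),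
      IsZMonoprime ↥𝔭.submonoid ∨ IsQMonoprime ↥𝔭.submonoid)
    (hsat₂ : ∀ (W : D'), ∀ x ∈ C₂.Φ.carrier (op W), ∃ (N : ℕ+) (d : dm₂.Φ₀.obj (C₂.baseOp (op W))),
      x ^ (N : ℕ) = (hpf₂ (C₂.baseOp (op W))).weak.toRealification (Perfection.of _ d)) :
    Literature.AnabelianGeometry.EtaleTheta.Cor38_ii
      (fun E _ Φ => ∀ (A : E) (α : Aut (Over.forget A)),
        (∀ (B : Over A) (x : Φ.obj (op B.left)),
          Literature.AlgebraicGeometry.Frobenioids.pull Φ (α.hom.app B) x = x) → α = 1) h :=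
  h.cor38_ii_ofRlfZWeak_of_ratSupport
    (C₁.isFrobenioid_of_structural (RealifiedDivisorMonoids.ofRlfZWeak_hBinj dm₁ hpf₁ hB₀inj₁) hFSM₁)
    (C₂.isFrobenioid_of_structural (RealifiedDivisorMonoids.ofRlfZWeak_hBinj dm₂ hpf₂ hB₀inj₂) hFSM₂)
    h34₁ hF₀inv₁ hcyc₁ hZQ₁ hsat₁ h34₂ hF₀inv₂ hcyc₂ hZQ₂ hsat₂

/-- **[EtTh] Cor. 3.8 (ii) AS TYPED for two tempered Frobenioids over the WEAK constructed Def. 3.6 (i) data of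
monoid type `ℚ`** (`RealifiedDivisorMonoids.ofRlfQWeak dm hpf`: `B₀^ℚ = B₀^pf`, `F₀^ℚ = F₀^pf`), any category
vocabularies, modulo `hF_i` and the same `B₀`/`Φ₀`-level print statements `dm_i.Prop34`, `hF₀inv_i`, `hcyc_i`, `hZQ_i`,
`hsat_i` (C38-L05 by abc-iut-L6-t12's `bsFldPreStepLimitCriterion_ofRlfQWeak_of_ratSupport`, Rmk. 3.6.3 by its
`remark363_ofRlfQWeak`). [cite: MochizukiEtTh2009, Cor 3.8 p.81] -/
theorem cor38_ii_ofRlfQWeak_of_ratSupport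
    {C₁ : TemperedFrobenioid (RealifiedDivisorMonoids.ofRlfQWeak dm₁ hpf₁) D VD}
    {C₂ : TemperedFrobenioid (RealifiedDivisorMonoids.ofRlfQWeak dm₂ hpf₂) D' VD'}
    (h : Cor38Hyp C₁ C₂)
    (hF₁ : PreFrobenioid.IsFrobenioid C₁.toElem) (hF₂ : PreFrobenioid.IsFrobenioid C₂.toElem)
    (h34₁ : dm₁.Prop34 V₁ V₀₁)
    (hF₀inv₁ : ∀ (Y : D₀ᵒᵖ) (b : dm₁.B₀.obj Y), b ∈ dm₁.F₀ Y → ∃ b' ∈ dm₁.F₀ Y, b' * b = 1)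
    (hcyc₁ : ∀ Y : D₀ᵒᵖ, ∃ d : dm₁.Φ₀.obj Y, ∀ b ∈ dm₁.F₀ Y, ∃ n : ℤ,
      dm₁.div₀ Y b = Algebra.GrothendieckGroup.of d ^ n)
    (hZQ₁ : ∀ (W : D) (𝔭 : Primes (dm₁.Φ₀.obj (C₁.baseOp (op W)))),
      IsZMonoprime ↥𝔭.submonoid ∨ IsQMonoprime ↥𝔭.submonoid)
    (hsat₁ : ∀ (W : D), ∀ x ∈ C₁.Φ.carrier (op W), ∃ (N : ℕ+) (d : dm₁.Φ₀.obj (C₁.baseOp (op W))),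
      x ^ (N : ℕ) = (hpf₁ (C₁.baseOp (op W))).weak.toRealification (Perfection.of _ d))
    (h34₂ : dm₂.Prop34 V₂ V₀₂)
    (hF₀inv₂ : ∀ (Y : D₀'ᵒᵖ) (b : dm₂.B₀.obj Y), b ∈ dm₂.F₀ Y → ∃ b' ∈ dm₂.F₀ Y, b' * b = 1)
    (hcyc₂ : ∀ Y : D₀'ᵒᵖ, ∃ d : dm₂.Φ₀.obj Y, ∀ b ∈ dm₂.F₀ Y, ∃ n : ℤ,
      dm₂.div₀ Y b = Algebra.GrothendieckGroup.of d ^ n)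
    (hZQ₂ : ∀ (W : D') (𝔭 : Primes (dm₂.Φ₀.obj (C₂.baseOp (op W)))),
      IsZMonoprime ↥𝔭.submonoid ∨ IsQMonoprime ↥𝔭.submonoid)
    (hsat₂ : ∀ (W : D'), ∀ x ∈ C₂.Φ.carrier (op W), ∃ (N : ℕ+) (d : dm₂.Φ₀.obj (C₂.baseOp (op W))),
      x ^ (N : ℕ) = (hpf₂ (C₂.baseOp (op W))).weak.toRealification (Perfection.of _ d)) :
    Literature.AnabelianGeometry.EtaleTheta.Cor38_ii
      (fun E _ Φ => ∀ (A : E) (α : Aut (Over.forget A)),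
        (∀ (B : Over A) (x : Φ.obj (op B.left)),
          Literature.AlgebraicGeometry.Frobenioids.pull Φ (α.hom.app B) x = x) → α = 1) h :=
  h.cor38_ii_weak_of_criteria hF₁ hF₂
    (C₁.bsFldPreStepLimitCriterion_ofRlfQWeak_of_ratSupport hF₁ h34₁ hcyc₁ hZQ₁ hsat₁)
    (C₂.bsFldPreStepLimitCriterion_ofRlfQWeak_of_ratSupport hF₂ h34₂ hcyc₂ hZQ₂ hsat₂)
    (C₁.remark363_ofRlfQWeak h34₁ hF₀inv₁) (C₂.remark363_ofRlfQWeak h34₂ hF₀inv₂)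

/-- **[EtTh] Cor. 3.8 (ii) AS TYPED over the weak constructed `Λ = ℚ` data from NAMED `B₀`/`Φ₀`/`D`-LEVEL CLAUSES
ONLY** (canonical category vocabulary): `hF_i` ⟸ (`hB₀inj_i`, `hFSM_i`) through `isFrobenioid_of_structural` ∘
`RealifiedDivisorMonoids.ofRlfQWeak_hBinj`; `hcyc_i` ⟸ `dm_i.Prop34Const`.  Inputs per side: `hB₀inj_i`, `hFSM_i`,
`dm_i.Prop34`, `dm_i.Prop34Const`, `hF₀inv_i`, `hZQ_i`, `hsat_i`. [cite: MochizukiEtTh2009, Cor 3.8 p.81] -/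
theorem cor38_ii_ofRlfQWeak_of_structural
    {C₁ : TemperedFrobenioid (RealifiedDivisorMonoids.ofRlfQWeak dm₁ hpf₁) D
      (treeCatVocab D IsRational IsStrictlyRational)}
    {C₂ : TemperedFrobenioid (RealifiedDivisorMonoids.ofRlfQWeak dm₂ hpf₂) D'
      (treeCatVocab D' IsRational' IsStrictlyRational')}
    (h : Cor38Hyp C₁ C₂)
    (hB₀inj₁ : ∀ {Y Y' : D₀ᵒᵖ} (g : Y ⟶ Y'), Injective (dm₁.B₀.map g).hom)
    (hFSM₁ : ∀ {A B : D} (α : B ⟶ A), IsFSM α → IsIso α)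
    (h34₁ : dm₁.Prop34 V₁ V₀₁) (hC₁ : dm₁.Prop34Const)
    (hF₀inv₁ : ∀ (Y : D₀ᵒᵖ) (b : dm₁.B₀.obj Y), b ∈ dm₁.F₀ Y → ∃ b' ∈ dm₁.F₀ Y, b' * b = 1)
    (hZQ₁ : ∀ (W : D) (𝔭 : Primes (dm₁.Φ₀.obj (C₁.baseOp (op W)))),
      IsZMonoprime ↥𝔭.submonoid ∨ IsQMonoprime ↥𝔭.submonoid)
    (hsat₁ : ∀ (W : D), ∀ x ∈ C₁.Φ.carrier (op W), ∃ (N : ℕ+) (d : dm₁.Φ₀.obj (C₁.baseOp (op W))),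
      x ^ (N : ℕ) = (hpf₁ (C₁.baseOp (op W))).weak.toRealification (Perfection.of _ d))
    (hB₀inj₂ : ∀ {Y Y' : D₀'ᵒᵖ} (g : Y ⟶ Y'), Injective (dm₂.B₀.map g).hom)
    (hFSM₂ : ∀ {A B : D'} (α : B ⟶ A), IsFSM α → IsIso α)
    (h34₂ : dm₂.Prop34 V₂ V₀₂) (hC₂ : dm₂.Prop34Const)
    (hF₀inv₂ : ∀ (Y : D₀'ᵒᵖ) (b : dm₂.B₀.obj Y), b ∈ dm₂.F₀ Y → ∃ b' ∈ dm₂.F₀ Y, b' * b = 1)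
    (hZQ₂ : ∀ (W : D') (𝔭 : Primes (dm₂.Φ₀.obj (C₂.baseOp (op W)))),
      IsZMonoprime ↥𝔭.submonoid ∨ IsQMonoprime ↥𝔭.submonoid)
    (hsat₂ : ∀ (W : D'), ∀ x ∈ C₂.Φ.carrier (op W), ∃ (N : ℕ+) (d : dm₂.Φ₀.obj (C₂.baseOp (op W))),
      x ^ (N : ℕ) = (hpf₂ (C₂.baseOp (op W))).weak.toRealification (Perfection.of _ d)) :
    Literature.AnabelianGeometry.EtaleTheta.Cor38_ii
      (fun E _ Φ => ∀ (A : E) (α : Aut (Over.forget A)),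
        (∀ (B : Over A) (x : Φ.obj (op B.left)),
          Literature.AlgebraicGeometry.Frobenioids.pull Φ (α.hom.app B) x = x) → α = 1) h :=
  h.cor38_ii_ofRlfQWeak_of_ratSupport
    (C₁.isFrobenioid_of_structural (RealifiedDivisorMonoids.ofRlfQWeak_hBinj dm₁ hpf₁ hB₀inj₁) hFSM₁)
    (C₂.isFrobenioid_of_structural (RealifiedDivisorMonoids.ofRlfQWeak_hBinj dm₂ hpf₂ hB₀inj₂) hFSM₂)
    h34₁ hF₀inv₁ hC₁.hcyc hZQ₁ hsat₁ h34₂ hF₀inv₂ hC₂.hcyc hZQ₂ hsat₂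

end OfRlfWeak

end Cor38Hyp

end Literature.AnabelianGeometry.EtaleTheta

end
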